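/-
Origin: expansion seat `planner-pub-hodgecm-mc-unitary-1-g3-0`, handover #3 2026-08-19T00:50Z md5 6c4588efb662ad939df6564692027cb3 (NEW additive leaf, 95 l., node E binder wm = (v19-a) SAN-6 companion: NON-VACUITY of the R7 record binder type — `theorem hasThetaMajorants_const` (constant family g ↦ id has Weil majorants, kernel: summable_norm_ratPt), `def WmInput.trivial V S : WmInput V S` (F := ℚ, ι := Fin 1, GU = G := Circle, lattices ⊤, ρ := 1, SK := univ, eV = eW : (`HOME/mc/pub-hodgecm-mc-unitary-1-g3/work/pkg/HodgeCM/Model/WmInputTrivial.lean`, md5 6c4588ef, 95 lines);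
landed by the gen-9 packager (p-g9) in gate run 33 as `HodgeCM/Model/WmInputTrivial.lean` (verbatim).
-/
/-
Copyright: pub-hodgecm construction cell. Seat planner-pub-hodgecm-mc-unitary-1-g3-0 (node (v19-a) `wm` producer).
-/
import Summits.HodgeConjecture.HodgeCM.Model.WmInstance
import Literature.NumberTheory.Weil1964.AdelicThetaDistribution

/-!
# NON-VACUITY of the `wm` input record `WmInput V S` (SAN-6 companion of `HodgeCM.Model.WmInstance` rev-c)

E R7 quantifies `W : ∀ {L ι₁} (V : HermSpace3 L ι₁) (c : SeesawCtx L), WmInput V c.D`.  This leaf shows the binder TYPE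
is inhabited for every `V, S` — so R7's `W` is not vacuously satisfiable-by-absurdity and not secretly `False`:
`WmInput.trivial V S` is the TRIVIAL Weil datum (base field `ℚ`, one coordinate, both receiving groups the circle
acting through the identity operator, `𝒮^κ = 𝒮(𝔸_ℚ)`), whose only non-definitional field — Weil's theta
majorants for the constant family `g ↦ id` — is the absolute convergence `Σ_{ξ ∈ ℚ} |Φ(ξ)| < ∞` of a
Schwartz–Bruhat function (`summable_norm_ratPt`, vendored weil-1/theta-1 tree theorem).

THIS IS NOT THE MODEL OF RECORD.  The `wm` field E is meant to consume is `wmOf' hP (wmInputCM …)` (v1, after the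
K-1 vendoring of the (P1)/(J-ρ)/(J-CM) cone: GR91 pair splitting, Weil's `ω_ψ`, the CM carriers); `WmInput.trivial`
exists only so that the sanity lane can register `Nonempty (WmInput V S)` (and hence a degenerate but honest
inhabitant of every R7 binder built from `W`).  KERNEL only: 1 theorem + 1 data def + 3 `rfl` lemmas + 1 instance-free
`Nonempty` corollary; 0 records, nothing cited as a hypothesis.
-/

set_option autoImplicit false

noncomputable section

namespace HodgeCM.Model

open HodgeCM.Adelic Literature.NumberTheory.Weil1964 Literature.NumberTheory.Automorphic NumberField

/-- **The constant family `g ↦ id` has theta majorants**: its terms `g ↦ Φ(ξ)` are constant, and `|Φ(ξ)|` itself is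
one summable majorant on the whole group ([Weil1964, Chap. III n° 41, Lemme 5 p. 192] in its most degenerate case;
kernel: `summable_norm_ratPt`). -/
theorem hasThetaMajorants_const (F : Type) [Field F] [NumberField F] (ι : Type) [Fintype ι]
    (G : Type) [TopologicalSpace G] :
    HasThetaMajorants (F := F) (ι := ι) (fun (_ : G) (Φ : piSchwartzBruhat F ι) => Φ) where
  continuous_eval _ _ := continuous_const
  exists_majorant Φ _ :=
    ⟨Set.univ, Filter.univ_mem, fun ξ => ‖(Φ : (ι → AdeleRing (𝓞 F) F) → ℂ) (ratPt F ι ξ)‖,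
      summable_norm_ratPt Φ.2, fun _ _ _ => le_rfl⟩

variable {L : CMField} {ι₁ : L →+* ℂ}

/-- **A (degenerate) inhabitant of `WmInput V S`** — NON-VACUITY ONLY, see the module docstring: base field `ℚ`,
index type `Fin 1`, `GU = G = Circle` with the trivial lattices `⊤`, `ρ = 1` (so `hrat` is `one_mem` and the
majorants are `hasThetaMajorants_const`), `𝒮^κ = univ`, and the trivial (continuous) homomorphisms from the adelic
unitary groups. -/
def WmInput.trivial (V : HermSpace3 L ι₁) (S : StubTree.SeesawDatum L) : WmInput V S where
  F := ℚ
  ι := Fin 1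
  GU := Circle
  ΓU := ⊤
  G := Circle
  Γ := ⊤
  ρ := 1
  hρ := hasThetaMajorants_const ℚ (Fin 1) (Circle × Circle)
  hrat _ _ _ _ := one_mem _
  SK := Set.univ
  SK_stable _ _ _ := Set.mem_univ _
  SK_zero := Set.mem_univ _
  SK_add _ _ := Set.mem_univ _
  SK_smul _ _ _ := Set.mem_univ _
  eV := 1
  heV := continuous_const
  hΓV _ _ := Subgroup.mem_top _
  eW := 1
  heW := continuous_const
  hΓW _ _ := Subgroup.mem_top _

/-- `WmInput V S` is inhabited for every `V, S` (SAN-6: E R7's binder `W` has an inhabitant). -/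
theorem nonempty_wmInput (V : HermSpace3 L ι₁) (S : StubTree.SeesawDatum L) : Nonempty (WmInput V S) :=
  ⟨WmInput.trivial V S⟩

/-- Hence the R7-shaped binder type `∀ {L ι₁} V c, WmInput V c.D` is inhabited. -/
theorem nonempty_wmInput_family :
    Nonempty (∀ {L : CMField} {ι₁ : L →+* ℂ} (V : HermSpace3 L ι₁) (c : SeesawCtx L), WmInput V c.D) :=
  ⟨fun V c => WmInput.trivial V c.D⟩

/-- (Ported verbatim from the HodgeCMPerL package; no docstring in the source.) -/
@[simp] theorem WmInput.trivial_SK (V : HermSpace3 L ι₁) (S : StubTree.SeesawDatum L) :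
    (WmInput.trivial V S).SK = Set.univ := rfl

/-- The degenerate model `wmOf' hP (WmInput.trivial V S)` acts by the identity … -/
@[simp] theorem wmOf'_trivial_W_act (hP : PrintFact_unitaryCompact) (V : HermSpace3 L ι₁) (S : StubTree.SeesawDatum L)
    (p : Circle × Circle) (Φ : piSchwartzBruhat ℚ (Fin 1)) :
    (wmOf' hP (WmInput.trivial V S)).W.act p Φ = Φ := rfl

/-- … and its `Θ_Φ(S)` is the plain theta distribution `Θ(Φ) = Σ_{ξ ∈ ℚ} Φ(ξ)` for every `S`. -/
@[simp] theorem wmOf'_trivial_W_theta (hP : PrintFact_unitaryCompact) (V : HermSpace3 L ι₁)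
    (S : StubTree.SeesawDatum L) (Φ : piSchwartzBruhat ℚ (Fin 1)) (p : Circle × Circle) :
    (wmOf' hP (WmInput.trivial V S)).W.theta Φ p = thetaDistLM ℚ (Fin 1) Φ := rfl

end HodgeCM.Model

end
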